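import Summits.BirchSwinnertonDyer.Rank1Residual.Supersingular.KobayashiMainConjecture
import Literature.NumberTheory.EllipticCurves.Rank1Residual.Predicates
import Literature.NumberTheory.EllipticCurves.PAdicBSD
import Literature.NumberTheory.EllipticCurves.IwasawaAlgebraDivisibilityProofs
import Literature.NumberTheory.EllipticCurves.IwasawaAlgebraCharIdealProofs
import Literature.NumberTheory.EllipticCurves.Kato2004.EulerSystemBoundFineSelmerTwo
import Literature.NumberTheory.EllipticCurves.Kobayashi2003.SignedSelmerDualExistsProofs
import Literature.NumberTheory.EllipticCurves.TateModuleContinuityProofs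
import Literature.NumberTheory.EllipticCurves.TateModuleFreeProofs
import Summits.BirchSwinnertonDyer.BirchSwinnertonDyer.Theorems.ThetaPartnerAtTwoSignedKatoUpToAtTwoFineRestriction
import Mathlib.Algebra.Module.CharacterModule
import HarnessLib

/-!
# Seed crux `SignedMuSeedAtTwoPlus` (stmt-BirchSwinnertonDyer-21438), stub S1 `stub_flatPlusLocalHalfAtTwo` of the lines
# `kolyvagin_char_two` / `pt_trivial_half` / `fine_plus_split`: the PLUS-LOCAL HALF ITSELF from a Coleman–Poitou–Tate
# μ-package — «the image of `Sel^ε(E/K_∞)[p]` in `H¹/Sel₀` is finite» — WITHOUT (F) (route-independent; any number field,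
# prime, sign; and S1's text BY SHAPE at `p = 2`)

Cell `bsd-wall`, width seat `bsd-wall-rtt-p4-w2` g8 (step (Z4) of the pt-trivial-half decomposition of S1). Companion of
`…SignedMuSeedAtTwoPlusPlusLocalMuRoad` (this seat: package + (F) ⇒ `X^ε` torsion, `μ^ε = 0`). HERE no (F): the package ALONE
gives the registered stub's conclusion `PlusLocalHalf W κ`. THEOREMS ONLY — no definition, no named fact, no instance, no `sorry`;
every arithmetic input is a displayed hypothesis; nothing about any curve is asserted; closes no item; BSD is NOT proved by this.

## The argument (Kobayashi (7.17) read at `𝔭 = (p)`, then Pontryagin)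

For ANY pinned datum `D` of `Sel^ε(E/K_∞)` (not necessarily finitely generated), `Y` of `Sel₀`, the pinned restriction
`k : X^ε → X₀` (`SignedKatoOffTwo.FineRestriction`: `Y.toDual (k x) = D.toDual x ∘ ι₀`), a submodule `P ≤ Λ`, `Λ`-linear
`j : P → X^ε` with COVER `ker k ≤ range j`, and `ξ ∈ P` with `j ξ = 0`, `p ∤ ξ`:
* §1 `ker k ↪ range j ≅ P/ker j` is killed by `ξ ∉ (p)`, so `ℓ_{(p)}(ker k) = 0`; `range j` is finitely generated over `Λ`
  (`Λ` Noetherian, `P ≤ Λ`), hence so is `ker k`; so `ker k` is finitely generated over `ℤ_p` (`finite_of_lengthAt_eq_zero`).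
* §2 `ker k` = the characters of `Sel^ε` vanishing on `Sel₀` = the Pontryagin dual of `M = Sel^ε/Sel₀`; `ℤ_p`-generators
  `x₁,…,xₙ` of `ker k` evaluate `p`-torsion classes into the finite `(ℚ/ℤ[p])ⁿ`, and two classes of `Sel^ε[p]` with the same
  values differ by an element of `Sel₀` (characters of `Sel^ε/Sel₀` separate points; `toDual_C_smul` for the `ℤ_p`-span) —
  so the image of `Sel^ε[p]` in `H¹/Sel₀` is finite: `finite_image_signedSelmer_pTorsion_of_muPackage`.
* §3 `p = 2`: with `γ` a topological generator (exists for every `κ`) and the CANONICAL pinned datum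
  `Kobayashi2003.signedSelmerDualData` (tree, `SignedSelmerDualExistsProofs`), the habitat μ-package hypothesis in the binders of
  S1 (newform, `ϖ`, Pollack pair, FLAT scalar, cyclotomic `κ`) + `γ`, `D` gives **S1's text `FlatPlusLocalHalfAtTwo`**
  (`flatPlusLocalHalfAtTwo_of_muPackage`): the stub S1 IS «(Z1)+(Z2)+(Z3) packaged», (Z4) being this file.

References: [Kobayashi2003] (7.17)–(7.21), Thm. 7.3 (pp. 12–13); [GreenbergLNM1716] §1 p. 60 (Pontryagin duals as `Λ`-modules);
[GreenbergVatsal2000] Prop. (2.8); [Washington1997] §13.2; [LimSujatha2018] §3 (before Prop. 3.2).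
-/

set_option autoImplicit false
-- the Theorems namespace of this sub repeats the summit name by design (D-0017 nested layout)
set_option linter.dupNamespace false

noncomputable section

open scoped Classical NumberField MatrixGroups ModularForm

open WeierstrassCurve Field IsDedekindDomain CongruenceSubgroup
  Literature.NumberTheory.GaloisRepresentations
  Literature.NumberTheory.EllipticCurves Literature.NumberTheory.EllipticCurves.Module
  Literature.NumberTheory.EllipticCurves.ModularForms
  Literature.NumberTheory.EllipticCurves.IwasawaAlgebra Literature.NumberTheory.EllipticCurves.Kobayashi2003
  Literature.NumberTheory.EllipticCurves.Rank1Residual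
  Literature.NumberTheory.EllipticCurves.Kato2004 ZpExtension
  Summit.BirchSwinnertonDyer.Rank1Residual.Supersingular Summit.BirchSwinnertonDyer.Rank1Residual.X1

namespace Summit.BirchSwinnertonDyer.BirchSwinnertonDyer.Theorems

namespace SignedMuAtTwo.PlusLocalMuRoad

universe u

/-! ## §1 `ker k` is finitely generated over `ℤ_p` (no (F), no finite generation of `X^ε`) -/

section Kernel

variable {p : ℕ} [Fact p.Prime] {X Y : Type*} [AddCommGroup X] [_root_.Module (IwasawaAlgebra p) X]
  [AddCommGroup Y] [_root_.Module (IwasawaAlgebra p) Y]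

/-- **μ-package ⇒ `ℓ_{(p)}(ker k) = 0`** (`ker k ↪ range j ≅ P/ker j`, killed by `ξ ∉ (p)`).
[cite: Kobayashi2003, (7.17) and (7.21) (pp. 12–13)] [cite: Washington1997, §13.2] -/
theorem lengthAt_ker_eq_zero_of_muPackage (P : Submodule (IwasawaAlgebra p) (IwasawaAlgebra p))
    (j : P →ₗ[IwasawaAlgebra p] X) (k : X →ₗ[IwasawaAlgebra p] Y) {ξ : IwasawaAlgebra p} (hξP : ξ ∈ P)
    (hξ : ¬ PowerSeries.C (p : ℤ_[p]) ∣ ξ) (hjξ : j ⟨ξ, hξP⟩ = 0)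
    (hcover : LinearMap.ker k ≤ LinearMap.range j) (𝔭 : PrimeSpectrum (IwasawaAlgebra p))
    (h𝔭 : 𝔭.asIdeal = augIdealP p) :
    lengthAt (IwasawaAlgebra p) (LinearMap.ker k) 𝔭 = 0 := by
  have h3 : lengthAt (IwasawaAlgebra p) (LinearMap.ker k) 𝔭 ≤ lengthAt (IwasawaAlgebra p) (LinearMap.range j) 𝔭 :=
    lengthAt_le_of_injective (Submodule.inclusion hcover) (Submodule.inclusion_injective hcover) 𝔭
  have h4 : lengthAt (IwasawaAlgebra p) (LinearMap.range j) 𝔭 = 0 := by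
    rw [← lengthAt_eq_of_linearEquiv j.quotKerEquivRange 𝔭]
    refine lengthAt_eq_zero_of_isTorsionBy (s := ξ) (fun x ↦ ?_) 𝔭 ?_
    · induction x using Submodule.Quotient.induction_on with
      | H y =>
        rw [← Submodule.Quotient.mk_smul, Submodule.Quotient.mk_eq_zero, LinearMap.mem_ker]
        have hy : ξ • y = (y : IwasawaAlgebra p) • (⟨ξ, hξP⟩ : P) :=
          Subtype.ext (by simp only [SetLike.val_smul, smul_eq_mul, mul_comm])
        rw [hy, map_smul, hjξ, smul_zero]
    · rw [h𝔭, augIdealP, Ideal.mem_span_singleton]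
      exact hξ
  exact le_antisymm (h3.trans h4.le) zero_le

/-- **μ-package ⇒ `ker k` is finitely generated over `ℤ_p`** (as a `Λ`-module it is a submodule of the finitely generated
`range j`, `Λ` being Noetherian and `P ≤ Λ` finitely generated; its length at `(p)` vanishes; `finite_of_lengthAt_eq_zero`).
The `ℤ_p`-structure is the restriction of scalars along `ℤ_p → Λ`. [cite: Washington1997, §13.2] [cite: GreenbergLNM1716, §1 p. 60] -/
theorem moduleFinite_padicInt_ker_of_muPackage (P : Submodule (IwasawaAlgebra p) (IwasawaAlgebra p))
    (j : P →ₗ[IwasawaAlgebra p] X) (k : X →ₗ[IwasawaAlgebra p] Y) {ξ : IwasawaAlgebra p} (hξP : ξ ∈ P)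
    (hξ : ¬ PowerSeries.C (p : ℤ_[p]) ∣ ξ) (hjξ : j ⟨ξ, hξP⟩ = 0)
    (hcover : LinearMap.ker k ≤ LinearMap.range j) :
    Module.Finite ℤ_[p] (RestrictScalars ℤ_[p] (IwasawaAlgebra p) (LinearMap.ker k)) := by
  -- `ker k` is finitely generated over `Λ`
  haveI : IsNoetherian (IwasawaAlgebra p) P := isNoetherian_submodule' P
  haveI : Module.Finite (IwasawaAlgebra p) (LinearMap.range j) := Module.Finite.range j
  haveI : IsNoetherian (IwasawaAlgebra p) (LinearMap.range j) := isNoetherian_of_isNoetherianRing_of_finite _ _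
  haveI : Module.Finite (IwasawaAlgebra p) (LinearMap.ker k) :=
    Module.Finite.of_injective (Submodule.inclusion hcover) (Submodule.inclusion_injective hcover)
  letI : _root_.Module ℤ_[p] (LinearMap.ker k) :=
    Module.compHom (LinearMap.ker k) (algebraMap ℤ_[p] (IwasawaAlgebra p))
  haveI : IsScalarTower ℤ_[p] (IwasawaAlgebra p) (LinearMap.ker k) := IsScalarTower.of_compHom ℤ_[p] _ _
  exact finite_of_lengthAt_eq_zero p (LinearMap.ker k) ⟨augIdealP p, isPrime_augIdealP_holds p⟩ rfl
    (lengthAt_ker_eq_zero_of_muPackage P j k hξP hξ hjξ hcover _ rfl)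

end Kernel

/-! ## §2 Pontryagin: a `ℤ_p`-finite `ker k` makes the image of `Sel^ε[p]` in `H¹/Sel₀` finite -/

section Pontryagin

variable {K : Type u} [Field K] [NumberField K] {W : WeierstrassCurve K} {p : ℕ} [Fact p.Prime]
  {κ : ZpExtension K p} {γ : Field.absoluteGaloisGroup K} {ε : ℤˣ}

/-- **If the characters of `Sel^ε(E/K_∞)` vanishing on `Sel₀` form a finitely generated `ℤ_p`-module, the image of
`Sel^ε(E/K_∞)[p]` in `H¹(K_∞, E[p^∞])/Sel₀` is finite.** With `ℤ_p`-generators `x₁, …, xₙ` of `ker k` (`k` the pinned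
restriction `X^ε → X₀`): `s ↦ (xᵢ(s))ᵢ ∈ (ℚ/ℤ[p])ⁿ`; two `p`-torsion classes with equal values are killed by every element of
the `ℤ_p`-span (`toDual_C_smul`), i.e. by every character of `Sel^ε` vanishing on `Sel₀`, hence are congruent modulo `Sel₀`
(characters of `Sel^ε/Sel₀` separate points). [cite: GreenbergLNM1716, §1 p. 60] [cite: LimSujatha2018, §3 (before Prop. 3.2)] -/
theorem finite_image_signedSelmer_pTorsion_of_moduleFinite_ker [W.IsElliptic] (D : SignedSelmerDualData W κ γ ε)
    (Y : W.FineSelmerDualData κ γ) (k : D.X →ₗ[IwasawaAlgebra p] Y.X)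
    (hk : ∀ (x : D.X) (s : W.fineSelmerInfty κ),
      Y.toDual (k x) s = D.toDual x (AddSubgroup.inclusion (fineSelmerInfty_le_signedSelmerInfty W κ ε) s))
    (hfg : Module.Finite ℤ_[p] (RestrictScalars ℤ_[p] (IwasawaAlgebra p) (LinearMap.ker k))) :
    ((QuotientAddGroup.mk' (W.fineSelmerInfty κ)) ''
      {x : W.subgroupH1 p κ.kerSubgroup | x ∈ signedSelmerInfty W κ ε ∧ p • x = 0}).Finite := by
  obtain ⟨G, hG⟩ := hfg
  set M₀ : Set (W.subgroupH1 p κ.kerSubgroup) :=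
    {x | x ∈ signedSelmerInfty W κ ε ∧ p • x = 0} with hM₀
  -- the finite target
  have hT : {u : AddCircle (1 : ℚ) | p • u = 0}.Finite := AddCircle.finite_torsion (1 : ℚ) (Fact.out : p.Prime).pos
  haveI : Finite {u : AddCircle (1 : ℚ) | p • u = 0} := hT.to_subtype
  -- evaluation of a `p`-torsion class of `Sel^ε` at the generators of `ker k`
  let ev : M₀ → ({x : RestrictScalars ℤ_[p] (IwasawaAlgebra p) (LinearMap.ker k) // x ∈ G} →
      {u : AddCircle (1 : ℚ) | p • u = 0}) :=
    fun s x ↦ ⟨D.toDual ((show LinearMap.ker k from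
        (x.1 : RestrictScalars ℤ_[p] (IwasawaAlgebra p) (LinearMap.ker k))) : D.X) ⟨s.1, s.2.1⟩, by
      change p • D.toDual _ (⟨s.1, s.2.1⟩ : signedSelmerInfty W κ ε) = 0
      rw [← map_nsmul]
      have : p • (⟨s.1, s.2.1⟩ : signedSelmerInfty W κ ε) = 0 := Subtype.ext s.2.2
      rw [this, map_zero]⟩
  -- two classes with the same values are congruent modulo `Sel₀`
  have key : ∀ s s' : M₀, ev s = ev s' →
      QuotientAddGroup.mk' (W.fineSelmerInfty κ) s.1 = QuotientAddGroup.mk' (W.fineSelmerInfty κ) s'.1 := by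
    intro s s' hss'
    -- every element of `ker k` takes the same value at `s` and `s'`
    have hgen : ∀ x : RestrictScalars ℤ_[p] (IwasawaAlgebra p) (LinearMap.ker k),
        D.toDual ((show LinearMap.ker k from x) : D.X) ⟨s.1, s.2.1⟩ =
          D.toDual ((show LinearMap.ker k from x) : D.X) ⟨s'.1, s'.2.1⟩ := by
      intro x
      have hx : x ∈ Submodule.span ℤ_[p]
          (G : Set (RestrictScalars ℤ_[p] (IwasawaAlgebra p) (LinearMap.ker k))) := by
        rw [hG]; exact Submodule.mem_top
      refine Submodule.span_induction (M := RestrictScalars ℤ_[p] (IwasawaAlgebra p) (LinearMap.ker k))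
        (p := fun y _ ↦ D.toDual ((show LinearMap.ker k from y) : D.X) ⟨s.1, s.2.1⟩ =
          D.toDual ((show LinearMap.ker k from y) : D.X) ⟨s'.1, s'.2.1⟩) ?_ ?_ ?_ ?_ hx
      · intro y hy
        have := congrArg (fun f ↦ ((f ⟨y, Finset.mem_coe.mp hy⟩ : {u : AddCircle (1 : ℚ) | p • u = 0}) :
          AddCircle (1 : ℚ))) hss'
        exact this
      · change D.toDual ((0 : LinearMap.ker k) : D.X) _ = D.toDual ((0 : LinearMap.ker k) : D.X) _
        rw [Submodule.coe_zero, map_zero, AddMonoidHom.zero_apply, AddMonoidHom.zero_apply]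
      · intro y z _ _ hy hz
        change D.toDual (((show LinearMap.ker k from y) + (show LinearMap.ker k from z) : LinearMap.ker k) : D.X) _ =
          D.toDual (((show LinearMap.ker k from y) + (show LinearMap.ker k from z) : LinearMap.ker k) : D.X) _
        rw [Submodule.coe_add, map_add, AddMonoidHom.add_apply, AddMonoidHom.add_apply, hy, hz]
      · intro c y _ hy
        have e : c • y = (show RestrictScalars ℤ_[p] (IwasawaAlgebra p) (LinearMap.ker k) from
            PowerSeries.C c • (show LinearMap.ker k from y)) := by
          rw [RestrictScalars.smul_def, ← PowerSeries.C_eq_algebraMap]; rfl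
        rw [e]
        change D.toDual ((PowerSeries.C c • (show LinearMap.ker k from y) : LinearMap.ker k) : D.X) _ =
          D.toDual ((PowerSeries.C c • (show LinearMap.ker k from y) : LinearMap.ker k) : D.X) _
        have h1 : p ^ 1 • (⟨s.1, s.2.1⟩ : signedSelmerInfty W κ ε) = 0 := by
          rw [pow_one]; exact Subtype.ext s.2.2
        have h2 : p ^ 1 • (⟨s'.1, s'.2.1⟩ : signedSelmerInfty W κ ε) = 0 := by
          rw [pow_one]; exact Subtype.ext s'.2.2
        rw [Submodule.coe_smul, D.toDual_C_smul c _ _ 1 h1, D.toDual_C_smul c _ _ 1 h2, hy]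
    -- characters of `Sel^ε` vanishing on `Sel₀` separate points modulo `Sel₀`
    rw [QuotientAddGroup.mk'_apply, QuotientAddGroup.mk'_apply, QuotientAddGroup.eq_iff_sub_mem]
    by_contra hmem
    -- the class of `s - s'` in `Sel^ε / (Sel₀ ∩ Sel^ε)` is non-zero
    set N₀ : AddSubgroup (signedSelmerInfty W κ ε) := (W.fineSelmerInfty κ).addSubgroupOf (signedSelmerInfty W κ ε)
      with hN₀
    set t : signedSelmerInfty W κ ε := ⟨s.1, s.2.1⟩ - ⟨s'.1, s'.2.1⟩ with ht
    have htN : (QuotientAddGroup.mk t : signedSelmerInfty W κ ε ⧸ N₀) ≠ 0 := by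
      intro h0
      rw [QuotientAddGroup.eq_zero_iff, hN₀, AddSubgroup.mem_addSubgroupOf] at h0
      exact hmem (by simpa [ht] using h0)
    obtain ⟨χ, hχ⟩ := CharacterModule.exists_character_apply_ne_zero_of_ne_zero htN
    -- pull back to a character of `Sel^ε` vanishing on `Sel₀`; it is `D.toDual x` for some `x ∈ ker k`
    set χ' : signedSelmerInfty W κ ε →+ AddCircle (1 : ℚ) := χ.comp (QuotientAddGroup.mk' N₀) with hχ'
    obtain ⟨x, hx⟩ := D.bijective.2 χ'
    have hxker : x ∈ LinearMap.ker k := by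
      rw [SignedKatoOffTwo.FineRestriction.mem_ker_fineRestrict_iff W κ D Y k hk x]
      intro u
      rw [hx, hχ', AddMonoidHom.comp_apply, QuotientAddGroup.mk'_apply,
        (QuotientAddGroup.eq_zero_iff _).mpr (by rw [hN₀, AddSubgroup.mem_addSubgroupOf]; exact u.2)]
      exact map_zero χ
    have hval := hgen (show RestrictScalars ℤ_[p] (IwasawaAlgebra p) (LinearMap.ker k) from ⟨x, hxker⟩)
    change D.toDual x _ = D.toDual x _ at hval
    have hzero : χ' t = 0 := by
      rw [ht, map_sub, ← hx]
      exact sub_eq_zero.mpr hval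
    -- `χ' t = χ (mk t)` definitionally
    exact hχ hzero
  -- conclusion: the image is covered by finitely many values
  refine (Set.finite_range (fun v : Set.range ev ↦
    QuotientAddGroup.mk' (W.fineSelmerInfty κ) (v.2.choose).1)).subset ?_
  rintro y ⟨x, hx, rfl⟩
  refine ⟨⟨ev ⟨x, hx⟩, ⟨⟨x, hx⟩, rfl⟩⟩, ?_⟩
  have hspec := (⟨⟨x, hx⟩, rfl⟩ : ev ⟨x, hx⟩ ∈ Set.range ev).choose_spec
  exact key _ _ hspec

/-- **μ-package (no (F)) ⇒ plus-local half**: for ANY pinned `D`, `Y`, pinned restriction `k`, `P ≤ Λ`, `j : P → X^ε` with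
cover `ker k ≤ range j`, and `ξ ∈ P` with `j ξ = 0`, `p ∤ ξ`: the image of `Sel^ε(E/K_∞)[p]` in `H¹(K_∞, E[p^∞])/Sel₀` is
finite. [cite: Kobayashi2003, (7.17)–(7.21) (pp. 12–13)] [cite: GreenbergLNM1716, §1 p. 60] -/
theorem finite_image_signedSelmer_pTorsion_of_muPackage [W.IsElliptic] (D : SignedSelmerDualData W κ γ ε)
    (Y : W.FineSelmerDualData κ γ) (P : Submodule (IwasawaAlgebra p) (IwasawaAlgebra p))
    (j : P →ₗ[IwasawaAlgebra p] D.X) (k : D.X →ₗ[IwasawaAlgebra p] Y.X)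
    (hk : ∀ (x : D.X) (s : W.fineSelmerInfty κ),
      Y.toDual (k x) s = D.toDual x (AddSubgroup.inclusion (fineSelmerInfty_le_signedSelmerInfty W κ ε) s))
    {ξ : IwasawaAlgebra p} (hξP : ξ ∈ P) (hξ : ¬ PowerSeries.C (p : ℤ_[p]) ∣ ξ) (hjξ : j ⟨ξ, hξP⟩ = 0)
    (hcover : LinearMap.ker k ≤ LinearMap.range j) :
    ((QuotientAddGroup.mk' (W.fineSelmerInfty κ)) ''
      {x : W.subgroupH1 p κ.kerSubgroup | x ∈ signedSelmerInfty W κ ε ∧ p • x = 0}).Finite :=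
  finite_image_signedSelmer_pTorsion_of_moduleFinite_ker D Y k hk
    (moduleFinite_padicInt_ker_of_muPackage P j k hξP hξ hjξ hcover)

end Pontryagin

/-! ## §3 `p = 2`: the registered stub S1 `FlatPlusLocalHalfAtTwo` BY SHAPE from the habitat μ-package -/

section AtTwo

/-- **S1 `stub_flatPlusLocalHalfAtTwo` (text VERBATIM, `PlusLocalHalf` unfolded) from the habitat⁺ μ-PACKAGE.** Hypothesis
`hPkg` (displayed; the content of (Z1)+(Z2)+(Z3)): for every habitat⁺ curve `W`, newform `f`, `ϖ` with `ϖ Ω_W = Ω⁺_f`,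
Pollack pair at `2` with the FLAT scalar `v₂(ϖ) + μ(L♭) = 0` (EXACTLY S1's binders), every cyclotomic `κ` with topological
generator `γ` and EVERY pinned datum `D` of `Sel⁺(W/ℚ_∞)`: a pinned `𝐇¹_Γ(T₂W)`-datum `I`, fine datum `Y`, `P ≤ Λ`,
`col : 𝐇¹ → P`, `j : P → X⁺` with `j ∘ col = 0` (global reciprocity), the PINNED restriction `k : X⁺ → X₀` with COVER
`ker k ≤ range j` (Kobayashi (7.17) at `p = 2`, `Δ < 0`), a genuine `2`-adic Euler-system class `s` and the μ-clause `2 ∤ col s`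
(μ-exact ERL⁺ at `2` + FLAT). Conclusion: for every habitat⁺ `W`, …, cyclotomic `κ`, the image of `Sel⁺(W/ℚ_∞)[2]` in
`H¹/Sel₀` is finite. Uses the CANONICAL pinned datum `Kobayashi2003.signedSelmerDualData` and a topological generator of `κ`
(`κ.surjective`); NO (F), NO finite generation. [cite: Kobayashi2003, (7.17)–(7.21), Thm. 7.3 (pp. 12–13), Thm. 6.3 (p. 11)]
[cite: Kato2004Asterisque, Thm. 12.5 (p. 222), §13.1 (p. 224)] [cite: GreenbergLNM1716, §1 p. 60] -/
theorem flatPlusLocalHalfAtTwo_of_muPackage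
    (hPkg : ∀ (W : WeierstrassCurve ℚ) [W.IsElliptic] [W.IsGloballyMinimal], ¬ W.HasCM → W.analyticRank = 0 →
      GoodSS W 2 → W.frobeniusTrace 2 = 0 → W.Δ < 0 →
      ∀ [NeZero (W.conductorNorm ℤ)] (f : CuspForm (Gamma0 (W.conductorNorm ℤ)) 2), IsNewformOf W f →
      ∀ (ϖ : ℚ), (ϖ : ℝ) * W.realPeriodRat = plusPeriod f →
      ∀ (Lplus Lminus : IwasawaAlgebra 2), IsPollackPair f 2 Lplus Lminus →
      padicValRat 2 ϖ + MuLambda.mu Lminus = 0 →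
      ∀ [ContinuousSMul ℤ_[2] (W.tateModule 2)] [Module.Free ℤ_[2] (W.tateModule 2)]
        [Module.Finite ℤ_[2] (W.tateModule 2)]
        (κ : ZpExtension ℚ 2) (γ : Field.absoluteGaloisGroup ℚ) (hκ : κ.IsCyclotomic), κ.IsTopGenerator γ →
      ∀ (D : SignedSelmerDualData W κ γ 1),
      ∃ (I : Kato2004.IwasawaH1Data W 2 κ γ) (Y : W.FineSelmerDualData κ γ)
        (P : Submodule (IwasawaAlgebra 2) (IwasawaAlgebra 2))
        (col : I.H →ₗ[IwasawaAlgebra 2] P) (j : P →ₗ[IwasawaAlgebra 2] D.X)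
        (k : D.X →ₗ[IwasawaAlgebra 2] Y.X) (s : I.H),
        (∀ x : I.H, j (col x) = 0) ∧
        (∀ (x : D.X) (t : W.fineSelmerInfty κ),
          Y.toDual (k x) t = D.toDual x (AddSubgroup.inclusion (fineSelmerInfty_le_signedSelmerInfty W κ 1) t)) ∧
        LinearMap.ker k ≤ LinearMap.range j ∧
        Kato2004.IsEulerSystemClassTwo W hκ I s ∧ ¬ PowerSeries.C (2 : ℤ_[2]) ∣ (P.subtype (col s))) :
    ∀ (W : WeierstrassCurve ℚ) [W.IsElliptic] [W.IsGloballyMinimal], ¬ W.HasCM → W.analyticRank = 0 →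
      GoodSS W 2 → W.frobeniusTrace 2 = 0 → W.Δ < 0 →
      ∀ [NeZero (W.conductorNorm ℤ)] (f : CuspForm (Gamma0 (W.conductorNorm ℤ)) 2), IsNewformOf W f →
      ∀ (ϖ : ℚ), (ϖ : ℝ) * W.realPeriodRat = plusPeriod f →
      ∀ (Lplus Lminus : IwasawaAlgebra 2), IsPollackPair f 2 Lplus Lminus →
      padicValRat 2 ϖ + MuLambda.mu Lminus = 0 →
      ∀ (κ : ZpExtension ℚ 2), κ.IsCyclotomic →
        ((QuotientAddGroup.mk' (W.fineSelmerInfty κ)) ''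
          {x : W.subgroupH1 2 κ.kerSubgroup | x ∈ signedSelmerInfty W κ 1 ∧ 2 • x = 0}).Finite := by
  intro W _ _ hCM hr hss ha hΔ _ f hf ϖ hϖ Lplus Lminus hP hflat κ hκ
  obtain ⟨γ, hγ⟩ : ∃ γ : Field.absoluteGaloisGroup ℚ, κ.IsTopGenerator γ := κ.surjective (Multiplicative.ofAdd 1)
  haveI : ContinuousSMul ℤ_[2] (W.tateModule 2) := TateModule.continuousSMul_padicInt
  haveI : Module.Free ℤ_[2] (W.tateModule 2) := module_free_tateModule_holds W 2
  haveI : Module.Finite ℤ_[2] (W.tateModule 2) := module_finite_tateModule_holds W 2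
  obtain ⟨I, Y, P, col, j, k, s, hcompl, hk, hcover, _hES, hμ⟩ :=
    hPkg W hCM hr hss ha hΔ f hf ϖ hϖ Lplus Lminus hP hflat κ γ hκ hγ (signedSelmerDualData W κ 1 hγ)
  refine finite_image_signedSelmer_pTorsion_of_muPackage (signedSelmerDualData W κ 1 hγ) Y P j k hk (col s).2 hμ ?_ hcover
  rw [Subtype.coe_eta]
  exact hcompl s

end AtTwo

end SignedMuAtTwo.PlusLocalMuRoad

end Summit.BirchSwinnertonDyer.BirchSwinnertonDyer.Theorems

end
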